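import Mathlib
import Summits.ResolutionOfSingularities.ResolutionOfSingularities.Theorems.HomologicalConductorSurfaceTerminationCubicConeCa
import HarnessLib

/-!
# Kill test `SurfaceTermination` (stmt-ResolutionOfSingularities-16488), (R-QH) piece 2 «CUBIC TRIANGLE», part 1:
# `(∂f) ⊆ ca³ ⊆ ca ⊆ 𝔪²` for EVERY plane cubic cone through the coordinate triangle, every field `k`

Route `ResolutionOfSingularities/HomologicalConductor` (cell `res-hironaka`, chain W4.4), kill test `SurfaceTermination`
(stmt-16488), residue stub `stub_initialPairOfConstantGenus` ((E)-form, registry r8 c2da4ae6bde8d476); res-L0-w44-plan-1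
CHAIN v21 (ρ35e) / v23 standing offer **(R-QH)**, piece 2 (generalisation of `…CubicConeCa`, p543906), res-D-pv-045 g7.
OURS; AI-written, weaker than expert review; nothing here is a statement of the manuscript under review (Hironaka 2017)
and no statement of it is used; no theorem here concludes the kill test or the crux.

THE FAMILY. `f_a = a₀X₀²X₁ + a₁X₀²X₂ + a₂X₁²X₂ + a₃X₁²X₀ + a₄X₂²X₀ + a₅X₂²X₁ + a₆X₀X₁X₂` (`a : Fin 7 → k`) = ALL plane cubics
through the three coordinate points `(1:0:0), (0:1:0), (0:0:1)`; over an algebraically closed field every smooth plane cubic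
is projectively equivalent to a member (move three non-collinear points to the coordinate points), so the cones over the
`f_a` contain every simple-elliptic `Ẽ₆` cone up to coordinates. `a = (1,0,1,0,1,0,0)` is the cone of `…CubicConeCa`.
At the local model `S_Q ⧸ (f)`, `S_Q = k[X₀,X₁,X₂]_Q`, `hQ : Q = originIdeal k 3`, and for a GENERAL `f` where stated:
* §1 the ruling test, second form `CubicCone`-style: `τ a = τ b = 0`, `τ q₁, τ q₂ ∈ I` ⇒ `τ c ∈ I`
  (`map_mem_of_koszul_certificate'`), and the LOCAL ENGINE for a general `f ≠ 0`
  (`mk_algebraMap_not_mem_cohomologyAnnihilatorOfDegree_of_test'`; res-D-pv-026's LOST criterion p521040);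
* §2 the CEILING for a general `f ≠ 0` admitting the three RULING SPLITS `f = X_{i+1} q₁ + X_{i+2} q₂` with
  `q₁, q₂ ↦ (T²)` along `(…,T,…)` (`coeff_eq_zero_of_splits`, **`mem_sq_of_splits`**: `c̄ ∈ caⁿ ⇒ c ∈ 𝔪²`);
* §3 the splits for `f_a` — NO condition on `a` (`splits_cubicTriangle`), hence **`mem_sq_of_mem_ca_cubicTriangle`** for
  every `f_a ≠ 0`: the cohomology annihilator of EVERY cubic cone through the coordinate triangle lies in `𝔪²`;
* §4 the FLOOR for a general `f ≠ 0`: `(∂f/∂Xᵢ)‾ ∈ ca³(S_Q ⧸ (f))` (`mk_algebraMap_pderiv_mem_cohomologyAnnihilatorOfDegree_three'`,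
  res-D-pv-058's p522421 + [cite: IyengarTakahashi2014, Lemma 2.10 (1)]).
Part 2 (`…CubicTriangleExit`) derives the (E) initial pair and the exit along the weight valuation under `a₀ ≠ 0, a₂ ≠ 0`.
-/

noncomputable section

-- single-problem summit: the doubled namespace component `ResolutionOfSingularities` is forced
set_option linter.dupNamespace false

namespace Summit.ResolutionOfSingularities.ResolutionOfSingularities.Theorems.SurfaceTermination.CubicTriangle

open MvPolynomial
open Literature.RingTheory.CohomologyAnnihilator
open Literature.AlgebraicGeometry.Resolution
open Summit.ResolutionOfSingularities.ResolutionOfSingularities.Theorems.HomologicalConductor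
open Summit.ResolutionOfSingularities.ResolutionOfSingularities.Theorems.SurfaceTermination.CubicCone

universe u v

/-! ## §1 The ruling test (second form) and the local engine for a general `f` -/

section Koszul

variable {B : Type u} [CommRing B] {D : Type v} [CommRing D]

/-- **THE RULING TEST, second form.** `τ : B → D` a ring map, `I ⊆ D` an ideal with `τ a = τ b = 0` and `τ q₁, τ q₂ ∈ I`;
a certificate `c·1 = G Ψ + Φ E` over the Koszul factorisation `Φ = [[b, q₁],[−a, q₂]]`, `Ψ = [[q₂, −q₁],[a, b]]` of
`a q₁ + b q₂` forces **`τ c ∈ I`** (entry `(0,0)`: `c = G₀₀ q₂ + G₀₁ a + b E₀₀ + q₁ E₁₀`). [folklore] -/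
theorem map_mem_of_koszul_certificate' (τ : B →+* D) (I : Ideal D) {a b q₁ q₂ c : B} (ha : τ a = 0) (hb : τ b = 0)
    (hq₁ : τ q₁ ∈ I) (hq₂ : τ q₂ ∈ I) {G E : Matrix (Fin 2) (Fin 2) B}
    (hcert : c • (1 : Matrix (Fin 2) (Fin 2) B) = G * !![q₂, -q₁; a, b] + !![b, q₁; -a, q₂] * E) :
    τ c ∈ I := by
  have h00 := congrArg (fun M : Matrix (Fin 2) (Fin 2) B => τ (M 0 0)) hcert
  simp only [Matrix.smul_apply, Matrix.one_apply_eq, smul_eq_mul, mul_one, Matrix.add_apply, Matrix.mul_apply,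
    Fin.sum_univ_two, map_add, map_mul, Matrix.of_apply, Matrix.cons_val', Matrix.cons_val_zero,
    Matrix.cons_val_one, Matrix.cons_val_fin_one, Matrix.empty_val', ha, hb, mul_zero, add_zero, zero_mul, zero_add] at h00
  rw [h00]
  exact I.add_mem (I.mul_mem_left _ hq₂) (I.mul_mem_right _ hq₁)

end Koszul

section Local

variable (k : Type u) [Field k]

/-- **THE LOCAL ENGINE for a general `f` (OURS · W4.4 (R-QH)).** `Q = originIdeal k 3`, `S_Q = k[x,y,z]_Q`, `0 ≠ f = a q₁ + b q₂`,
a test vector `w : Fin 3 → k[T]` with `w i (0) = 0`, `a(w) = b(w) = 0`, `q₁(w), q₂(w) ∈ (T²)`: every polynomial `c` with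
`c(w) ∉ (T²)` has its class OUTSIDE `caᵐ(S_Q ⧸ (f))` for every `m` (Koszul factorisation pushed to `S_Q`, ruling test through
`τ_w : S_Q → k⟦T⟧`, res-D-pv-026's LOST criterion). [OURS · W4.4 kill test] -/
theorem mk_algebraMap_not_mem_cohomologyAnnihilatorOfDegree_of_test' (Q : Ideal (MvPolynomial (Fin 3) k)) [Q.IsPrime]
    (hQ : Q = originIdeal k 3) (f : MvPolynomial (Fin 3) k) (hf0 : f ≠ 0) {a b q₁ q₂ : MvPolynomial (Fin 3) k}
    (hf : a * q₁ + b * q₂ = f) (w : Fin 3 → Polynomial k) (hw : ∀ i, (w i).coeff 0 = 0)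
    (ha : MvPolynomial.aeval w a = 0) (hb : MvPolynomial.aeval w b = 0)
    (hq₁ : MvPolynomial.aeval w q₁ ∈ Ideal.span ({Polynomial.X ^ 2} : Set (Polynomial k)))
    (hq₂ : MvPolynomial.aeval w q₂ ∈ Ideal.span ({Polynomial.X ^ 2} : Set (Polynomial k)))
    (c : MvPolynomial (Fin 3) k) (hc : MvPolynomial.aeval w c ∉ Ideal.span ({Polynomial.X ^ 2} : Set (Polynomial k)))
    (m : ℕ) :
    Ideal.Quotient.mk (Ideal.span {algebraMap (MvPolynomial (Fin 3) k) (Localization.AtPrime Q) f})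
      (algebraMap (MvPolynomial (Fin 3) k) (Localization.AtPrime Q) c) ∉
      cohomologyAnnihilatorOfDegree (Localization.AtPrime Q ⧸
        Ideal.span {algebraMap (MvPolynomial (Fin 3) k) (Localization.AtPrime Q) f}) m := by
  subst hQ
  set S := Localization.AtPrime (originIdeal k 3)
  set ι : MvPolynomial (Fin 3) k →+* S := algebraMap (MvPolynomial (Fin 3) k) S with hι
  set τ₁ : MvPolynomial (Fin 3) k →+* PowerSeries k :=
    (Polynomial.coeToPowerSeries.ringHom : Polynomial k →+* PowerSeries k).comp
      (MvPolynomial.aeval (R := k) w).toRingHom with hτ₁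
  let τ : S →+* PowerSeries k :=
    IsLocalization.lift (M := (originIdeal k 3).primeCompl) (g := τ₁) (isUnit_coe_aeval_of_mem_primeCompl k w hw)
  have hτ : ∀ p : MvPolynomial (Fin 3) k, τ (ι p) = ((MvPolynomial.aeval w p : Polynomial k) : PowerSeries k) := by
    intro p
    rw [hι, IsLocalization.lift_eq]
    rfl
  have hinj : Function.Injective ι := IsLocalization.injective S (originIdeal k 3).primeCompl_le_nonZeroDivisors
  have hfS : ι f ∈ nonZeroDivisors S := by
    refine mem_nonZeroDivisors_of_ne_zero fun h => hf0 (hinj ?_)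
    rw [h, map_zero]
  haveI : IsNoetherianRing S := IsLocalization.isNoetherianRing (originIdeal k 3).primeCompl S inferInstance
  have hΦΨ : (!![ι b, ι q₁; -ι a, ι q₂] : Matrix (Fin 2) (Fin 2) S) * !![ι q₂, -ι q₁; ι a, ι b] =
      ι f • (1 : Matrix (Fin 2) (Fin 2) S) := by
    rw [koszulMF_mul, ← hf, map_add, map_mul, map_mul]
  have hΨΦ : (!![ι q₂, -ι q₁; ι a, ι b] : Matrix (Fin 2) (Fin 2) S) * !![ι b, ι q₁; -ι a, ι q₂] =
      ι f • (1 : Matrix (Fin 2) (Fin 2) S) := by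
    rw [koszulMF_mul', ← hf, map_add, map_mul, map_mul]
  have hdet : (!![ι b, ι q₁; -ι a, ι q₂] : Matrix (Fin 2) (Fin 2) S).det ∈ nonZeroDivisors S := by
    rw [koszulMF_det, ← map_mul, ← map_mul, ← map_add, hf]
    exact hfS
  have hT2 : ∀ {p : MvPolynomial (Fin 3) k}, MvPolynomial.aeval w p ∈ Ideal.span ({Polynomial.X ^ 2} : Set (Polynomial k)) →
      τ (ι p) ∈ Ideal.span ({PowerSeries.X ^ 2} : Set (PowerSeries k)) := fun hp => by
    rw [hτ, KC3Upper.coe_mem_span_X_pow_iff]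
    exact hp
  have ha' : τ (ι a) = 0 := by rw [hτ, ha, Polynomial.coe_zero]
  have hb' : τ (ι b) = 0 := by rw [hτ, hb, Polynomial.coe_zero]
  have hc' : τ (ι c) ∉ Ideal.span ({PowerSeries.X ^ 2} : Set (PowerSeries k)) := by
    rw [hτ, KC3Upper.coe_mem_span_X_pow_iff]
    exact hc
  exact LostCertificate.not_mem_cohomologyAnnihilatorOfDegree_of_not_exists_certificate (ι f) hfS
    !![ι b, ι q₁; -ι a, ι q₂] !![ι q₂, -ι q₁; ι a, ι b] hΦΨ hΨΦ hdet (ι c)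
    (fun ⟨_, _, h⟩ => hc' (map_mem_of_koszul_certificate' τ _ ha' hb' (hT2 hq₁) (hT2 hq₂) h)) m

/-! ## §2 The ceiling for a general `f` with the three ruling splits -/

/-- **THE CEILING FROM THREE RULING SPLITS (OURS · W4.4 (R-QH)).** `0 ≠ f ∈ k[X₀,X₁,X₂]`; suppose that for each `i` there is a
split `f = X_{i+1} q₁ + X_{i+2} q₂` (indices mod `3`) with `q₁, q₂ ↦ (T²)` along the ruling `(…,T,…)` (`T` in slot `i`). If the
class of a polynomial `c` lies in some `caⁿ(k[X]_Q ⧸ (f))` (`Q = originIdeal k 3`) then `c(0) = 0` and the coefficients of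
`X₀, X₁, X₂` in `c` vanish. [OURS · W4.4 kill test] -/
theorem coeff_eq_zero_of_splits (Q : Ideal (MvPolynomial (Fin 3) k)) [Q.IsPrime] (hQ : Q = originIdeal k 3)
    (f : MvPolynomial (Fin 3) k) (hf0 : f ≠ 0)
    (hsplit : ∀ i : Fin 3, ∃ q₁ q₂ : MvPolynomial (Fin 3) k, X (i + 1) * q₁ + X (i + 2) * q₂ = f ∧
      MvPolynomial.aeval (R := k) (Pi.single i (Polynomial.X : Polynomial k)) q₁ ∈
        Ideal.span ({Polynomial.X ^ 2} : Set (Polynomial k)) ∧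
      MvPolynomial.aeval (R := k) (Pi.single i (Polynomial.X : Polynomial k)) q₂ ∈
        Ideal.span ({Polynomial.X ^ 2} : Set (Polynomial k)))
    (c : MvPolynomial (Fin 3) k) {n : ℕ}
    (h : Ideal.Quotient.mk (Ideal.span {algebraMap (MvPolynomial (Fin 3) k) (Localization.AtPrime Q) f})
      (algebraMap (MvPolynomial (Fin 3) k) (Localization.AtPrime Q) c) ∈
      cohomologyAnnihilatorOfDegree (Localization.AtPrime Q ⧸
        Ideal.span {algebraMap (MvPolynomial (Fin 3) k) (Localization.AtPrime Q) f}) n) :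
    constantCoeff c = 0 ∧ ∀ i : Fin 3, coeff (Finsupp.single i 1) c = 0 := by
  have key : ∀ i : Fin 3, MvPolynomial.aeval (R := k) (Pi.single i (Polynomial.X : Polynomial k)) c ∈
      Ideal.span ({Polynomial.X ^ 2} : Set (Polynomial k)) := by
    intro i
    by_contra hc
    obtain ⟨q₁, q₂, hf, hq₁, hq₂⟩ := hsplit i
    have hw : ∀ l : Fin 3, ((Pi.single i (Polynomial.X : Polynomial k) : Fin 3 → Polynomial k) l).coeff 0 = 0 := by
      intro l
      by_cases hl : l = i
      · subst hl; simp
      · rw [Pi.single_eq_of_ne hl, Polynomial.coeff_zero]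
    have h1 : i + 1 ≠ i := by fin_cases i <;> decide
    have h2 : i + 2 ≠ i := by fin_cases i <;> decide
    exact mk_algebraMap_not_mem_cohomologyAnnihilatorOfDegree_of_test' k Q hQ f hf0 hf (Pi.single i Polynomial.X) hw
      (by rw [MvPolynomial.aeval_X, Pi.single_eq_of_ne h1]) (by rw [MvPolynomial.aeval_X, Pi.single_eq_of_ne h2])
      hq₁ hq₂ c hc n h
  have key' : ∀ i : Fin 3, coeff (Finsupp.single i 0) c = 0 ∧ coeff (Finsupp.single i 1) c = 0 := fun i => by
    have hi := (mem_span_X_sq_iff k _).mp (key i)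
    rw [coeff_aeval_single, coeff_aeval_single] at hi
    exact hi
  refine ⟨?_, fun i => (key' i).2⟩
  have h0 := (key' 0).1
  rwa [Finsupp.single_zero, ← constantCoeff_eq] at h0

/-- **THE CEILING `ca ⊆ 𝔪²` FROM THREE RULING SPLITS (OURS · W4.4 (R-QH)).** Under the hypotheses of `coeff_eq_zero_of_splits`:
`c̄ ∈ caⁿ(k[X]_Q ⧸ (f)) ⇒ c ∈ 𝔪² = (X₀,X₁,X₂)²` (`idealOfVars`). [OURS · W4.4 kill test] -/
theorem mem_sq_of_splits (Q : Ideal (MvPolynomial (Fin 3) k)) [Q.IsPrime] (hQ : Q = originIdeal k 3)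
    (f : MvPolynomial (Fin 3) k) (hf0 : f ≠ 0)
    (hsplit : ∀ i : Fin 3, ∃ q₁ q₂ : MvPolynomial (Fin 3) k, X (i + 1) * q₁ + X (i + 2) * q₂ = f ∧
      MvPolynomial.aeval (R := k) (Pi.single i (Polynomial.X : Polynomial k)) q₁ ∈
        Ideal.span ({Polynomial.X ^ 2} : Set (Polynomial k)) ∧
      MvPolynomial.aeval (R := k) (Pi.single i (Polynomial.X : Polynomial k)) q₂ ∈
        Ideal.span ({Polynomial.X ^ 2} : Set (Polynomial k)))
    (c : MvPolynomial (Fin 3) k) {n : ℕ}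
    (h : Ideal.Quotient.mk (Ideal.span {algebraMap (MvPolynomial (Fin 3) k) (Localization.AtPrime Q) f})
      (algebraMap (MvPolynomial (Fin 3) k) (Localization.AtPrime Q) c) ∈
      cohomologyAnnihilatorOfDegree (Localization.AtPrime Q ⧸
        Ideal.span {algebraMap (MvPolynomial (Fin 3) k) (Localization.AtPrime Q) f}) n) :
    c ∈ idealOfVars (Fin 3) k ^ 2 := by
  obtain ⟨h0, h1⟩ := coeff_eq_zero_of_splits k Q hQ f hf0 hsplit c h
  rw [mem_pow_idealOfVars_iff']
  intro m hm
  rcases eq_zero_or_eq_single_of_degree_lt_two m hm with rfl | ⟨i, rfl⟩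
  · rwa [← constantCoeff_eq]
  · exact h1 i

/-! ## §3 The family of cubics through the coordinate triangle -/

/-- **THE THREE RULING SPLITS OF `f_a` (OURS · W4.4 (R-QH)).** For EVERY `a : Fin 7 → k` the cubic
`f_a = a₀X₀²X₁ + a₁X₀²X₂ + a₂X₁²X₂ + a₃X₁²X₀ + a₄X₂²X₀ + a₅X₂²X₁ + a₆X₀X₁X₂` splits along each coordinate ruling:
`f_a = X₁(a₀X₀² + a₃X₁X₀ + a₂X₁X₂ + a₅X₂² + a₆X₀X₂) + X₂(a₁X₀² + a₄X₂X₀)` and cyclically, with `q₁, q₂ ↦ (aⱼT²) ⊆ (T²)` along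
`(T,0,0)` etc. No condition on `a`. [OURS · W4.4 kill test] -/
theorem splits_cubicTriangle (a : Fin 7 → k) (i : Fin 3) :
    ∃ q₁ q₂ : MvPolynomial (Fin 3) k, X (i + 1) * q₁ + X (i + 2) * q₂ =
      C (a 0) * (X 0 ^ 2 * X 1) + C (a 1) * (X 0 ^ 2 * X 2) + C (a 2) * (X 1 ^ 2 * X 2) + C (a 3) * (X 1 ^ 2 * X 0) +
        C (a 4) * (X 2 ^ 2 * X 0) + C (a 5) * (X 2 ^ 2 * X 1) + C (a 6) * (X 0 * X 1 * X 2) ∧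
      MvPolynomial.aeval (R := k) (Pi.single i (Polynomial.X : Polynomial k)) q₁ ∈
        Ideal.span ({Polynomial.X ^ 2} : Set (Polynomial k)) ∧
      MvPolynomial.aeval (R := k) (Pi.single i (Polynomial.X : Polynomial k)) q₂ ∈
        Ideal.span ({Polynomial.X ^ 2} : Set (Polynomial k)) := by
  fin_cases i
  · -- ruling `(T,0,0)`: `f = X₁·(a₀X₀² + a₃X₁X₀ + a₂X₁X₂ + a₅X₂² + a₆X₀X₂) + X₂·(a₁X₀² + a₄X₂X₀)`
    refine ⟨C (a 0) * X 0 ^ 2 + C (a 3) * X 1 * X 0 + C (a 2) * X 1 * X 2 + C (a 5) * X 2 ^ 2 + C (a 6) * X 0 * X 2,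
      C (a 1) * X 0 ^ 2 + C (a 4) * X 2 * X 0, ?_, ?_, ?_⟩
    · simp only [Fin.zero_eta, zero_add, Fin.isValue]; ring
    · simp [Ideal.mem_span_singleton]
    · simp [Ideal.mem_span_singleton]
  · -- ruling `(0,T,0)`: `f = X₂·(a₂X₁² + a₅X₂X₁ + a₄X₂X₀ + a₁X₀² + a₆X₁X₀) + X₀·(a₃X₁² + a₀X₀X₁)`
    refine ⟨C (a 2) * X 1 ^ 2 + C (a 5) * X 2 * X 1 + C (a 4) * X 2 * X 0 + C (a 1) * X 0 ^ 2 + C (a 6) * X 1 * X 0,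
      C (a 3) * X 1 ^ 2 + C (a 0) * X 0 * X 1, ?_, ?_, ?_⟩
    · simp only [Fin.mk_one, Fin.isValue]
      rw [show ((1 : Fin 3) + 1) = 2 from rfl, show ((1 : Fin 3) + 2) = 0 from rfl]
      ring
    · simp [Ideal.mem_span_singleton]
    · simp [Ideal.mem_span_singleton]
  · -- ruling `(0,0,T)`: `f = X₀·(a₄X₂² + a₁X₀X₂ + a₀X₀X₁ + a₃X₁² + a₆X₂X₁) + X₁·(a₅X₂² + a₂X₁X₂)`
    refine ⟨C (a 4) * X 2 ^ 2 + C (a 1) * X 0 * X 2 + C (a 0) * X 0 * X 1 + C (a 3) * X 1 ^ 2 + C (a 6) * X 2 * X 1,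
      C (a 5) * X 2 ^ 2 + C (a 2) * X 1 * X 2, ?_, ?_, ?_⟩
    · simp only [Fin.reduceFinMk, Fin.isValue]
      rw [show ((2 : Fin 3) + 1) = 0 from rfl, show ((2 : Fin 3) + 2) = 1 from rfl]
      ring
    · simp [Ideal.mem_span_singleton]
    · simp [Ideal.mem_span_singleton]

/-- **THE CEILING FOR EVERY CUBIC CONE THROUGH THE COORDINATE TRIANGLE (OURS · W4.4 (R-QH)).** For every field `k` and every
`a : Fin 7 → k` with `f_a ≠ 0`: if the class of a polynomial `c` lies in some `caⁿ(k[X]_Q ⧸ (f_a))` (`Q = originIdeal k 3`) then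
**`c ∈ 𝔪²`**. No smoothness hypothesis. [OURS · W4.4 kill test] -/
theorem mem_sq_of_mem_ca_cubicTriangle (Q : Ideal (MvPolynomial (Fin 3) k)) [Q.IsPrime] (hQ : Q = originIdeal k 3)
    (a : Fin 7 → k)
    (hf0 : (C (a 0) * (X 0 ^ 2 * X 1) + C (a 1) * (X 0 ^ 2 * X 2) + C (a 2) * (X 1 ^ 2 * X 2) + C (a 3) * (X 1 ^ 2 * X 0) +
      C (a 4) * (X 2 ^ 2 * X 0) + C (a 5) * (X 2 ^ 2 * X 1) + C (a 6) * (X 0 * X 1 * X 2) : MvPolynomial (Fin 3) k) ≠ 0)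
    (c : MvPolynomial (Fin 3) k) {n : ℕ}
    (h : Ideal.Quotient.mk (Ideal.span {algebraMap (MvPolynomial (Fin 3) k) (Localization.AtPrime Q)
        (C (a 0) * (X 0 ^ 2 * X 1) + C (a 1) * (X 0 ^ 2 * X 2) + C (a 2) * (X 1 ^ 2 * X 2) + C (a 3) * (X 1 ^ 2 * X 0) +
          C (a 4) * (X 2 ^ 2 * X 0) + C (a 5) * (X 2 ^ 2 * X 1) + C (a 6) * (X 0 * X 1 * X 2))})
      (algebraMap (MvPolynomial (Fin 3) k) (Localization.AtPrime Q) c) ∈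
      cohomologyAnnihilatorOfDegree (Localization.AtPrime Q ⧸
        Ideal.span {algebraMap (MvPolynomial (Fin 3) k) (Localization.AtPrime Q)
          (C (a 0) * (X 0 ^ 2 * X 1) + C (a 1) * (X 0 ^ 2 * X 2) + C (a 2) * (X 1 ^ 2 * X 2) + C (a 3) * (X 1 ^ 2 * X 0) +
            C (a 4) * (X 2 ^ 2 * X 0) + C (a 5) * (X 2 ^ 2 * X 1) + C (a 6) * (X 0 * X 1 * X 2))}) n) :
    c ∈ idealOfVars (Fin 3) k ^ 2 :=
  mem_sq_of_splits k Q hQ _ hf0 (splits_cubicTriangle k a) c h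

/-! ## §4 The floor for a general `f` -/

/-- **THE FLOOR for a general `f ≠ 0` (OURS · W4.4 (R-QH)).** `(∂f/∂Xᵢ)‾ ∈ ca³(k[X₀,X₁,X₂]_Q ⧸ (f))`, `Q = originIdeal k 3`:
res-D-pv-058's affine Jacobian criterion pushed to the localisation by Iyengar–Takahashi's Lemma 2.10 (1) and moved along
`Ideal.quotEquivOfEq`. [cite: IyengarTakahashi2014, Lemma 2.10 (1)] -/
theorem mk_algebraMap_pderiv_mem_cohomologyAnnihilatorOfDegree_three' (Q : Ideal (MvPolynomial (Fin 3) k)) [Q.IsPrime]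
    (hQ : Q = originIdeal k 3) (f : MvPolynomial (Fin 3) k) (hf0 : f ≠ 0) (i : Fin 3) :
    Ideal.Quotient.mk (Ideal.span {algebraMap (MvPolynomial (Fin 3) k) (Localization.AtPrime Q) f})
      (algebraMap (MvPolynomial (Fin 3) k) (Localization.AtPrime Q) (pderiv i f)) ∈
      cohomologyAnnihilatorOfDegree (Localization.AtPrime Q ⧸
        Ideal.span {algebraMap (MvPolynomial (Fin 3) k) (Localization.AtPrime Q) f}) 3 := by
  subst hQ
  set S := Localization.AtPrime (originIdeal k 3)
  have haff := PersistenceJacobianKept.pderiv_mem_cohomologyAnnihilatorOfDegree (d := 2) f hf0 i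
  have hloc := map_cohomologyAnnihilatorOfDegree_le_of_isLocalization
    (Algebra.algebraMapSubmonoid (MvPolynomial (Fin 3) k ⧸ Ideal.span {f}) (originIdeal k 3).primeCompl)
    (S ⧸ (Ideal.span {f}).map (algebraMap (MvPolynomial (Fin 3) k) S)) 3
    (Ideal.mem_map_of_mem _ haff)
  rw [Ideal.Quotient.algebraMap_quotient_map_quotient] at hloc
  have hmap : (Ideal.span {f}).map (algebraMap (MvPolynomial (Fin 3) k) S) =
      Ideal.span {algebraMap (MvPolynomial (Fin 3) k) S f} := by
    rw [Ideal.map_span, Set.image_singleton]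
  have h2 := ringEquiv_apply_mem_cohomologyAnnihilatorOfDegree
    (R := S ⧸ (Ideal.span {f}).map (algebraMap (MvPolynomial (Fin 3) k) S))
    (S := S ⧸ Ideal.span {algebraMap (MvPolynomial (Fin 3) k) S f}) (Ideal.quotEquivOfEq hmap) hloc
  rwa [Ideal.quotEquivOfEq_mk] at h2

end Local

end Summit.ResolutionOfSingularities.ResolutionOfSingularities.Theorems.SurfaceTermination.CubicTriangle

end
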